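import Literature.NumberTheory.LFunctions.LargeValuesS3Integral
import Mathlib.Analysis.PSeries
import Mathlib.NumberTheory.Divisors
import HarnessLib

/-!
# Tools for the sums over affine transformations (Guth–Maynard §9): affine substitution in the Fourier integral, Poisson summation for modulated bumps, periodised kernels, divisor counting

Topic `NumberTheory/LFunctions`, family RH. Part of the programme around the tree's named fact
`Literature.NumberTheory.LFunctions.zeroDensity_guth_maynard` (L. Guth, J. Maynard, *New large value
estimates for Dirichlet polynomials*, Ann. of Math. 203 (2026)), reduced by `LargeValuesEnergyBound.lean`
to Proposition 10.1, whose key input is Proposition 9.1 ("Equidistribution over affine transformations")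
proved through the long Fourier-analytic Lemma 9.2. This file collects, and PROVES, the elementary
analytic and arithmetic tools of that proof:

* §1 `fourier_comp_affine`: `𝓕[u ↦ f(au+b)](ξ) = |a|^{-1} e(bξ/a) f̂(ξ/a)` ("We do a change of variables
  `ũ = u + m₃/m₁` … The integral in parentheses is `(m₂/m₁) f̂(m₂ξ/m₁)`");
* §2 `fourier_ech_mul` (modulation), `fourier_dilate_modulate` and **Poisson summation for a
  modulated dilated bump** `tsum_bump_modulate_eq`:
  `∑_{n∈ℤ} ψ(n/M) e(nx) = ∑_{ℓ∈ℤ} M ψ̂(M(ℓ − x))` ("we can explicitly do the last sum by Poisson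
  summation. It is equal to `M₃ ∑_ℓ ψ̂₁(M₃(ℓ − ξ/m₁))`"), with the summability of the right-hand side;
* §3 the periodised kernel `perK Φ M x = ∑_{ℓ∈ℤ} M‖Φ(M(ℓ−x))‖` for `Φ` with `‖Φ(y)‖ ≤ K(1+|y|)^{-j}`:
  the lattice sum `∑_{ℓ∈F} (1+|ℓ−x|)^{-2} ≤ 8` (`sum_inv_one_add_sq_le`), the uniform bound
  `perK ≤ 8KM` (`perK_le`), the bound `8KMY^{2−j}` for the terms with `M|ℓ−x| > Y` (`sum_far_le`) and for the
  terms with `|ℓ| ≥ L` when `|x| ≤ X ≤ L − 1` (`sum_tail_le`);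
* §4 counting: integers in an interval (`card_int_near_le`), and factorisations `s = m·ℓ` of a non-zero
  integer (`card_mul_eq_le`: at most `2·d(|s|)` pairs), to be combined with the tree's divisor bound
  `Literature.NumberTheory.Sieve.exists_card_divisors_le_mul_rpow` ("each such integer `s` has `⪅ 1`
  factorizations as `s = m₁ℓ`").

No definition of mathematical content beyond `perK`; no named fact is introduced; everything is proved.

## References

* L. Guth, J. Maynard, *New large value estimates for Dirichlet polynomials*, Ann. of Math. (2)
  203 (2026), no. 2; arXiv:2405.20552 (2024): §9, proof of Lemma 9.2, eqs. (9.4)–(9.8).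
-/

noncomputable section

open Real Set Filter Topology Complex MeasureTheory Finset
open scoped FourierTransform ContDiff

namespace Literature.NumberTheory.LFunctions

namespace GuthMaynardAffine

open GuthMaynardFourier GuthMaynardS3

/-! ## §1. Affine substitution in the Fourier integral -/

/-- **`𝓕[u ↦ f(au+b)](ξ) = |a|^{-1} e(bξ/a) f̂(ξ/a)`** for `a ≠ 0`. [folklore] -/
theorem fourier_comp_affine (f : ℝ → ℂ) {a : ℝ} (ha : a ≠ 0) (b ξ : ℝ) :
    𝓕 (fun u ↦ f (a * u + b)) ξ = ((|a|⁻¹ : ℝ) : ℂ) * ech (b * ξ / a) * 𝓕 f (ξ / a) := by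
  rw [fourier_eq_integral_ech, fourier_eq_integral_ech]
  -- substitute `u = (y - b)/a`, i.e. `y = a u + b`
  have h1 : ∫ u, ech (-(u * ξ)) * f (a * u + b) = ∫ u, (fun y ↦ ech (-((y - b) / a * ξ)) * f y) (a * u + b) := by
    refine integral_congr_ae (Eventually.of_forall fun u ↦ ?_)
    simp only
    congr 2
    field_simp
    ring
  rw [h1, Measure.integral_comp_mul_left (fun u ↦ (fun y ↦ ech (-((y - b) / a * ξ)) * f y) (u + b)) a]
  rw [integral_add_right_eq_self (fun y ↦ ech (-((y - b) / a * ξ)) * f y) b]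
  rw [Complex.real_smul, ← integral_const_mul, ← integral_const_mul]
  refine integral_congr_ae (Eventually.of_forall fun y ↦ ?_)
  simp only
  have e : ech (-((y - b) / a * ξ)) = ech (b * ξ / a) * ech (-(y * (ξ / a))) := by
    rw [← ech_add]; congr 1; field_simp; ring
  rw [e, abs_inv]
  push_cast
  ring

/-! ## §2. Modulation, dilation and Poisson summation for a modulated bump -/

/-- **Modulation**: `𝓕[y ↦ e(yx) f(y)](ξ) = f̂(ξ − x)`. [folklore] -/
theorem fourier_ech_mul (f : ℝ → ℂ) (x ξ : ℝ) : 𝓕 (fun y ↦ ech (y * x) * f y) ξ = 𝓕 f (ξ - x) := by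
  rw [fourier_eq_integral_ech, fourier_eq_integral_ech]
  refine integral_congr_ae (Eventually.of_forall fun y ↦ ?_)
  simp only
  rw [← mul_assoc, ← ech_add]
  congr 2; ring

/-- **Dilation and modulation**: `𝓕[y ↦ ψ(y/M) e(yx)](ξ) = M ψ̂(M(ξ − x))` for `M > 0`. [folklore] -/
theorem fourier_dilate_modulate (ψ : ℝ → ℂ) {M : ℝ} (hM : 0 < M) (x ξ : ℝ) :
    𝓕 (fun y ↦ ψ (y / M) * ech (y * x)) ξ = (M : ℂ) * 𝓕 ψ (M * (ξ - x)) := by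
  have h1 : (fun y ↦ ψ (y / M) * ech (y * x)) = fun y ↦ ech (y * x) * (fun y ↦ ψ (y / M)) y := by
    ext y; ring
  rw [h1, fourier_ech_mul, fourier_comp_div ψ hM]

/-- A bound `‖F(ξ)‖ ≤ C|ξ|^{-2}` for `|ξ| ≥ R` (`R ≥ 1`) gives `F = O(|ξ|^{-2})` at infinity. [folklore] -/
theorem isBigO_cocompact_of_bound' {F : ℝ → ℂ} {C R : ℝ}
    (h : ∀ ξ : ℝ, R ≤ |ξ| → ‖F ξ‖ ≤ C * |ξ| ^ (-2 : ℝ)) :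
    F =O[cocompact ℝ] (fun x : ℝ ↦ |x| ^ (-2 : ℝ)) := by
  apply Asymptotics.IsBigO.of_bound C
  rw [Filter.eventually_iff_exists_mem]
  refine ⟨(Metric.closedBall 0 R)ᶜ, (isCompact_closedBall (0 : ℝ) R).compl_mem_cocompact, fun ξ hξ ↦ ?_⟩
  simp only [Set.mem_compl_iff, Metric.mem_closedBall, dist_zero_right, Real.norm_eq_abs, not_le] at hξ
  rw [Real.norm_of_nonneg (Real.rpow_nonneg (abs_nonneg _) _)]
  exact h ξ hξ.le

section bump

variable {ψ : ℝ → ℂ}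

/-- **Poisson summation for a modulated dilated bump**: for `ψ` smooth with compact support, `M > 0` and
real `x`, `∑_{n∈ℤ} ψ(n/M) e(nx) = ∑_{ℓ∈ℤ} M ψ̂(M(ℓ − x))`, and the right-hand side is (absolutely)
summable ("The first key point in our analysis is that we can explicitly do the last sum by Poisson
summation"). [cite: GuthMaynard2026, proof of Lemma 9.2, (9.5)] -/
theorem tsum_bump_modulate_eq (hψ : ContDiff ℝ ∞ ψ) (hψs : HasCompactSupport ψ) {M : ℝ} (hM : 0 < M)
    (x : ℝ) : Summable (fun ℓ : ℤ ↦ (M : ℂ) * 𝓕 ψ (M * (ℓ - x))) ∧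
      ∑' n : ℤ, ψ (n / M) * ech (n * x) = ∑' ℓ : ℤ, (M : ℂ) * 𝓕 ψ (M * (ℓ - x)) := by
  set F : ℝ → ℂ := fun y ↦ ψ (y / M) * ech (y * x) with hF
  have hFc : Continuous F := by
    simp only [hF]
    exact (hψ.continuous.comp (continuous_id.div_const M)).mul (continuous_ech.comp (continuous_id.mul continuous_const))
  have hFcs : HasCompactSupport F := by
    simp only [hF]
    refine HasCompactSupport.mul_right ?_
    exact hψs.comp_homeomorph (Homeomorph.mulRight₀ M⁻¹ (inv_ne_zero hM.ne')) |>.mono (by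
      intro y hy; simpa [div_eq_mul_inv] using hy)
  have hFO : F =O[cocompact ℝ] (fun y : ℝ ↦ |y| ^ (-(2 : ℝ))) := isBigO_cocompact_of_hasCompactSupport hFcs 2
  obtain ⟨K, hK0, hKb, hKd⟩ := GuthMaynardRFunction.fourier_decay hψ hψs 2
  have hFf_eq : ∀ ξ : ℝ, 𝓕 F ξ = (M : ℂ) * 𝓕 ψ (M * (ξ - x)) := fun ξ ↦ fourier_dilate_modulate ψ hM x ξ
  -- decay of `𝓕 F`
  have hFf : 𝓕 F =O[cocompact ℝ] (fun y : ℝ ↦ |y| ^ (-(2 : ℝ))) := by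
    refine isBigO_cocompact_of_bound' (R := max 1 (2 * |x|)) (C := 4 * K / M) fun ξ hξ ↦ ?_
    have hξ1 : 1 ≤ |ξ| := le_trans (le_max_left _ _) hξ
    have hξx : 2 * |x| ≤ |ξ| := le_trans (le_max_right _ _) hξ
    have hξx' : |ξ| / 2 ≤ |ξ - x| := by
      have := abs_sub_abs_le_abs_sub ξ x
      linarith
    have hξx0 : 0 < |ξ - x| := lt_of_lt_of_le (by linarith) hξx'
    have hne : M * (ξ - x) ≠ 0 := by
      refine mul_ne_zero hM.ne' fun h ↦ ?_
      rw [h, abs_zero] at hξx'; linarith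
    rw [hFf_eq, norm_mul, Complex.norm_real, Real.norm_of_nonneg hM.le]
    have h1 := hKd _ hne
    rw [abs_mul, abs_of_pos hM] at h1
    have h2 : K / (M * |ξ - x|) ^ 2 ≤ 4 * K / (M ^ 2 * |ξ| ^ 2) := by
      rw [div_le_div_iff₀ (by positivity) (by positivity)]
      have : M ^ 2 * |ξ| ^ 2 ≤ 4 * (M * |ξ - x|) ^ 2 := by
        rw [mul_pow]
        have h3 : |ξ| ^ 2 ≤ 4 * |ξ - x| ^ 2 := by nlinarith [abs_nonneg (ξ - x), abs_nonneg ξ]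
        nlinarith [sq_nonneg M]
      nlinarith
    calc M * ‖𝓕 ψ (M * (ξ - x))‖ ≤ M * (4 * K / (M ^ 2 * |ξ| ^ 2)) := mul_le_mul_of_nonneg_left (h1.trans h2) hM.le
      _ = 4 * K / M * |ξ| ^ (-2 : ℝ) := by
          rw [Real.rpow_neg (abs_nonneg _), show (2 : ℝ) = (2 : ℕ) by norm_num, Real.rpow_natCast]
          field_simp
  have hsum : Summable (fun ℓ : ℤ ↦ (M : ℂ) * 𝓕 ψ (M * (ℓ - x))) := by
    have := summable_of_isBigO (Real.summable_abs_int_rpow one_lt_two) (hFf.comp_tendsto Int.tendsto_coe_cofinite)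
    refine this.congr fun ℓ ↦ ?_
    simp only [Function.comp_apply, hFf_eq]
  refine ⟨hsum, ?_⟩
  have hP := Real.tsum_eq_tsum_fourier_of_rpow_decay hFc one_lt_two hFO hFf 0
  simp only [zero_add, QuotientAddGroup.mk_zero, fourier_eval_zero, mul_one] at hP
  rw [show (fun n : ℤ ↦ ψ (n / M) * ech (n * x)) = fun n : ℤ ↦ F n from rfl, hP]
  exact tsum_congr fun ℓ ↦ hFf_eq ℓ

/-- The left-hand side of Poisson's formula is a finite sum: if `ψ(y) = 0` for `|y| ≥ 3` then
`∑_{n∈ℤ} ψ(n/M)e(nx) = ∑_{|n| ≤ 3M} ψ(n/M)e(nx)` (`M > 0`). [folklore] -/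
theorem tsum_bump_modulate_eq_sum (hψ3 : ∀ y, 3 ≤ |y| → ψ y = 0) {M : ℝ} (hM : 0 < M) (x : ℝ) (N : ℕ)
    (hN : 3 * M ≤ N) :
    ∑' n : ℤ, ψ (n / M) * ech (n * x) = ∑ n ∈ Finset.Icc (-(N : ℤ)) N, ψ (n / M) * ech (n * x) := by
  apply tsum_eq_sum
  intro n hn
  rw [Finset.mem_Icc, not_and_or] at hn
  have hn' : (N : ℝ) < |(n : ℝ)| := by
    rcases hn with hn | hn
    · push Not at hn
      have : (n : ℝ) < -(N : ℝ) := by exact_mod_cast hn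
      rw [abs_of_neg (by linarith)]; linarith
    · push Not at hn
      have : (N : ℝ) < n := by exact_mod_cast hn
      rw [abs_of_pos (by linarith)]; linarith
  have : ψ (n / M) = 0 := by
    apply hψ3
    rw [abs_div, abs_of_pos hM, le_div_iff₀ hM]
    linarith
  rw [this, zero_mul]

end bump

/-! ## §3. Periodised kernels -/

/-- The periodised kernel `∑_{ℓ∈ℤ} M‖Φ(M(ℓ − x))‖`. [cite: GuthMaynard2026, proof of Lemma 9.2, (9.6)] -/
def perK (Φ : ℝ → ℂ) (M x : ℝ) : ℝ := ∑' ℓ : ℤ, M * ‖Φ (M * (ℓ - x))‖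

/-- **The lattice sum `∑_{ℓ∈F} (1+|ℓ−x|)^{-2} ≤ 8`** for every finite `F ⊂ ℤ` and real `x`. [folklore] -/
theorem sum_inv_one_add_sq_le (F : Finset ℤ) (x : ℝ) : ∑ ℓ ∈ F, ((1 + |(ℓ : ℝ) - x|) ^ 2)⁻¹ ≤ 8 := by
  classical
  -- shift by `⌊x⌋`
  set k : ℤ := ⌊x⌋ with hk
  have hx1 : (k : ℝ) ≤ x := Int.floor_le x
  have hx2 : x < k + 1 := Int.lt_floor_add_one x
  set G : Finset ℤ := F.image (fun ℓ ↦ ℓ - k) with hG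
  have hreindex : ∑ ℓ ∈ F, ((1 + |(ℓ : ℝ) - x|) ^ 2)⁻¹ = ∑ n ∈ G, ((1 + |((n + k : ℤ) : ℝ) - x|) ^ 2)⁻¹ := by
    rw [hG, Finset.sum_image (fun a _ b _ h ↦ by simpa using h)]
    refine Finset.sum_congr rfl fun ℓ _ ↦ ?_
    simp
  rw [hreindex]
  -- termwise bound by `b n`
  set b : ℤ → ℝ := fun n ↦ if 1 ≤ n then ((n : ℝ) ^ 2)⁻¹ else ((1 + |(n : ℝ)|) ^ 2)⁻¹ with hb
  have hterm : ∀ n : ℤ, ((1 + |((n + k : ℤ) : ℝ) - x|) ^ 2)⁻¹ ≤ b n := by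
    intro n
    simp only [hb]
    push_cast
    split_ifs with hn
    · have hn' : (1 : ℝ) ≤ n := by exact_mod_cast hn
      apply inv_anti₀ (by positivity)
      apply pow_le_pow_left₀ (by positivity)
      have : (n : ℝ) - 1 < |(n : ℝ) + k - x| := by
        rw [lt_abs]; left; linarith
      linarith
    · push Not at hn
      have hn' : (n : ℝ) ≤ 0 := by exact_mod_cast (show n ≤ 0 by omega)
      apply inv_anti₀ (by positivity)
      apply pow_le_pow_left₀ (by positivity)
      rw [abs_of_nonpos hn']
      have : -(n : ℝ) ≤ |(n : ℝ) + k - x| := by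
        rw [le_abs]; right; linarith
      linarith
  refine (Finset.sum_le_sum fun n _ ↦ hterm n).trans ?_
  -- `∑_{n ∈ G} b n ≤ ∑_{n ∈ Icc (-N) N} b n ≤ 8`
  obtain ⟨N, hN⟩ : ∃ N : ℕ, ∀ n ∈ G, -(N : ℤ) ≤ n ∧ n ≤ N := by
    rcases G.eq_empty_or_nonempty with h | h
    · exact ⟨0, by simp [h]⟩
    · refine ⟨max (G.max' h).natAbs (G.min' h).natAbs, fun n hn ↦ ⟨?_, ?_⟩⟩
      · have := G.min'_le n hn; omega
      · have := G.le_max' n hn; omega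
  have hb0 : ∀ n, 0 ≤ b n := fun n ↦ by simp only [hb]; split_ifs <;> positivity
  have hsub : G ⊆ Finset.Icc (-(N : ℤ)) N := fun n hn ↦ Finset.mem_Icc.mpr (hN n hn)
  refine (Finset.sum_le_sum_of_subset_of_nonneg hsub fun n _ _ ↦ hb0 n).trans ?_
  -- split into `n ≥ 1` and `n ≤ 0`
  have hsplit : Finset.Icc (-(N : ℤ)) N = Finset.Icc (-(N : ℤ)) 0 ∪ Finset.Icc 1 N := by
    ext n; simp only [Finset.mem_union, Finset.mem_Icc]; omega
  have hdisj : Disjoint (Finset.Icc (-(N : ℤ)) 0) (Finset.Icc 1 N) := by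
    rw [Finset.disjoint_left]; intro n h1 h2; simp only [Finset.mem_Icc] at h1 h2; omega
  rw [hsplit, Finset.sum_union hdisj]
  -- the positive part: `∑_{n=1}^{N} 1/n² ≤ 2`
  have hpos : ∑ n ∈ Finset.Icc (1 : ℤ) N, b n ≤ 2 := by
    have e : ∑ n ∈ Finset.Icc (1 : ℤ) N, b n = ∑ i ∈ Finset.Ioo 0 (N + 1), ((i : ℝ) ^ 2)⁻¹ := by
      rw [show Finset.Icc (1 : ℤ) N = (Finset.Ioo 0 (N + 1)).map Nat.castEmbedding from by
        ext n; simp only [Finset.mem_Icc, Finset.mem_map, Finset.mem_Ioo, Nat.castEmbedding_apply]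
        constructor
        · intro h; exact ⟨n.toNat, by omega, by omega⟩
        · rintro ⟨i, hi, rfl⟩; omega]
      rw [Finset.sum_map]
      refine Finset.sum_congr rfl fun i hi ↦ ?_
      rw [Finset.mem_Ioo] at hi
      simp only [hb, Nat.castEmbedding_apply, Int.cast_natCast]
      rw [if_pos (by exact_mod_cast hi.1)]
    rw [e]
    have := sum_Ioo_inv_sq_le (α := ℝ) 0 (N + 1)
    norm_num at this
    exact this
  -- the non-positive part: `∑_{n=-N}^{0} 1/(1+|n|)² ≤ ∑_{i=1}^{N+1} 1/i² ≤ 2`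
  have hneg : ∑ n ∈ Finset.Icc (-(N : ℤ)) 0, b n ≤ 2 := by
    have e : ∑ n ∈ Finset.Icc (-(N : ℤ)) 0, b n = ∑ i ∈ Finset.Ioo 0 (N + 2), ((i : ℝ) ^ 2)⁻¹ := by
      rw [show Finset.Icc (-(N : ℤ)) 0 = (Finset.Ioo 0 (N + 2)).image (fun i : ℕ ↦ 1 - (i : ℤ)) from by
        ext n; simp only [Finset.mem_Icc, Finset.mem_image, Finset.mem_Ioo]
        constructor
        · intro h; exact ⟨(1 - n).toNat, by omega, by omega⟩
        · rintro ⟨i, hi, rfl⟩; omega]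
      rw [Finset.sum_image (fun a _ b _ h ↦ by simpa using h)]
      refine Finset.sum_congr rfl fun i hi ↦ ?_
      rw [Finset.mem_Ioo] at hi
      simp only [hb]
      rw [if_neg (by omega)]
      congr 1
      have : ((1 - (i : ℤ) : ℤ) : ℝ) = 1 - (i : ℝ) := by push_cast; ring
      have hi1 : (1 : ℝ) ≤ i := by exact_mod_cast hi.1
      rw [this, abs_of_nonpos (by linarith)]
      ring
    rw [e]
    have := sum_Ioo_inv_sq_le (α := ℝ) 0 (N + 2)
    norm_num at this
    exact this
  linarith

/-- The terms of the periodised kernel are summable when `‖Φ(y)‖ ≤ K(1+|y|)^{-2}` (`M ≥ 1`), and every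
finite partial sum is `≤ 8KM`. [folklore] -/
theorem sum_perK_terms_le {Φ : ℝ → ℂ} {K : ℝ} (hK : 0 ≤ K) (hΦ : ∀ y, ‖Φ y‖ ≤ K / (1 + |y|) ^ 2)
    {M : ℝ} (hM : 1 ≤ M) (x : ℝ) (F : Finset ℤ) : ∑ ℓ ∈ F, M * ‖Φ (M * (ℓ - x))‖ ≤ 8 * K * M := by
  have hM0 : 0 < M := by linarith
  have hterm : ∀ ℓ : ℤ, M * ‖Φ (M * (ℓ - x))‖ ≤ K * M * ((1 + |(ℓ : ℝ) - x|) ^ 2)⁻¹ := by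
    intro ℓ
    have h1 := hΦ (M * (ℓ - x))
    have h2 : (1 + |(ℓ : ℝ) - x|) ^ 2 ≤ (1 + |M * (ℓ - x)|) ^ 2 := by
      apply pow_le_pow_left₀ (by positivity)
      rw [abs_mul, abs_of_pos hM0]
      have : |(ℓ : ℝ) - x| ≤ M * |(ℓ : ℝ) - x| := le_mul_of_one_le_left (abs_nonneg _) hM
      linarith
    calc M * ‖Φ (M * (ℓ - x))‖ ≤ M * (K / (1 + |M * (ℓ - x)|) ^ 2) := mul_le_mul_of_nonneg_left h1 hM0.le
      _ ≤ M * (K / (1 + |(ℓ : ℝ) - x|) ^ 2) := by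
          gcongr
      _ = K * M * ((1 + |(ℓ : ℝ) - x|) ^ 2)⁻¹ := by ring
  calc ∑ ℓ ∈ F, M * ‖Φ (M * (ℓ - x))‖ ≤ ∑ ℓ ∈ F, K * M * ((1 + |(ℓ : ℝ) - x|) ^ 2)⁻¹ := Finset.sum_le_sum fun ℓ _ ↦ hterm ℓ
    _ = K * M * ∑ ℓ ∈ F, ((1 + |(ℓ : ℝ) - x|) ^ 2)⁻¹ := by rw [Finset.mul_sum]
    _ ≤ K * M * 8 := mul_le_mul_of_nonneg_left (sum_inv_one_add_sq_le F x) (by positivity)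
    _ = 8 * K * M := by ring

/-- Summability of the terms of the periodised kernel (`‖Φ(y)‖ ≤ K(1+|y|)^{-2}`, `M ≥ 1`). [folklore] -/
theorem summable_perK_terms {Φ : ℝ → ℂ} {K : ℝ} (hK : 0 ≤ K) (hΦ : ∀ y, ‖Φ y‖ ≤ K / (1 + |y|) ^ 2)
    {M : ℝ} (hM : 1 ≤ M) (x : ℝ) : Summable (fun ℓ : ℤ ↦ M * ‖Φ (M * (ℓ - x))‖) := by
  refine summable_of_sum_le (fun ℓ ↦ mul_nonneg (by linarith) (norm_nonneg _)) (sum_perK_terms_le hK hΦ hM x)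

/-- **`perK Φ M x ≤ 8KM`** (`‖Φ(y)‖ ≤ K(1+|y|)^{-2}`, `M ≥ 1`). [cite: GuthMaynard2026, proof of Lemma 9.2] -/
theorem perK_le {Φ : ℝ → ℂ} {K : ℝ} (hK : 0 ≤ K) (hΦ : ∀ y, ‖Φ y‖ ≤ K / (1 + |y|) ^ 2)
    {M : ℝ} (hM : 1 ≤ M) (x : ℝ) : perK Φ M x ≤ 8 * K * M :=
  Real.tsum_le_of_sum_le (fun ℓ ↦ mul_nonneg (by linarith) (norm_nonneg _)) (sum_perK_terms_le hK hΦ hM x)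

/-- `perK ≥ 0`. [folklore] -/
theorem perK_nonneg (Φ : ℝ → ℂ) {M : ℝ} (hM : 0 ≤ M) (x : ℝ) : 0 ≤ perK Φ M x :=
  tsum_nonneg fun ℓ ↦ by positivity

/-- **The far terms**: if `‖Φ(y)‖ ≤ K(1+|y|)^{-j}` with `j ≥ 2`, `M ≥ 1`, `Y ≥ 1`, then for every finite set
`F` of integers `ℓ` with `M|ℓ − x| > Y`, `∑_{ℓ∈F} M‖Φ(M(ℓ−x))‖ ≤ 8KM·Y^{2−j}`
("`ψ̂₁(M₃(ℓ − ξ/m₁))` is negligible unless `|ξ − ℓm₁| ⪅ M₁/M₃`"). [cite: GuthMaynard2026, proof of Lemma 9.2, (9.6)] -/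
theorem sum_far_le {Φ : ℝ → ℂ} {K : ℝ} (hK : 0 ≤ K) {j : ℕ} (hj : 2 ≤ j)
    (hΦ : ∀ y, ‖Φ y‖ ≤ K / (1 + |y|) ^ j) {M : ℝ} (hM : 1 ≤ M) {Y : ℝ} (hY : 1 ≤ Y) (x : ℝ)
    (F : Finset ℤ) (hF : ∀ ℓ ∈ F, Y ≤ M * |(ℓ : ℝ) - x|) :
    ∑ ℓ ∈ F, M * ‖Φ (M * (ℓ - x))‖ ≤ 8 * K * M * Y ^ ((2 : ℝ) - j) := by
  have hM0 : 0 < M := by linarith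
  have hY0 : 0 < Y := by linarith
  have hterm : ∀ ℓ ∈ F, M * ‖Φ (M * (ℓ - x))‖ ≤ K * M * Y ^ ((2 : ℝ) - j) * ((1 + |(ℓ : ℝ) - x|) ^ 2)⁻¹ := by
    intro ℓ hℓ
    have h1 := hΦ (M * (ℓ - x))
    have hy : Y ≤ 1 + |M * ((ℓ : ℝ) - x)| := by
      rw [abs_mul, abs_of_pos hM0]; linarith [hF ℓ hℓ]
    -- `(1+|y|)^j ≥ (1+|y|)² Y^{j-2}` and `(1+|y|)² ≥ (1+|ℓ-x|)²`
    have e : ((1 + |M * ((ℓ : ℝ) - x)|) ^ j : ℝ) = (1 + |M * ((ℓ : ℝ) - x)|) ^ 2 * (1 + |M * ((ℓ : ℝ) - x)|) ^ (j - 2) := by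
      rw [← pow_add]; congr 1; omega
    have h2 : Y ^ (j - 2) ≤ (1 + |M * ((ℓ : ℝ) - x)|) ^ (j - 2) := pow_le_pow_left₀ hY0.le hy _
    have h3 : (1 + |(ℓ : ℝ) - x|) ^ 2 ≤ (1 + |M * ((ℓ : ℝ) - x)|) ^ 2 := by
      apply pow_le_pow_left₀ (by positivity)
      rw [abs_mul, abs_of_pos hM0]
      have : |(ℓ : ℝ) - x| ≤ M * |(ℓ : ℝ) - x| := le_mul_of_one_le_left (abs_nonneg _) hM
      linarith
    have h4 : K / (1 + |M * ((ℓ : ℝ) - x)|) ^ j ≤ K * Y ^ ((2 : ℝ) - j) * ((1 + |(ℓ : ℝ) - x|) ^ 2)⁻¹ := by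
      rw [e, Real.rpow_sub hY0, Real.rpow_two, Real.rpow_natCast, div_eq_mul_inv, div_eq_mul_inv, mul_inv]
      have hYj : (Y ^ j)⁻¹ * Y ^ 2 = ((Y ^ (j - 2))⁻¹ : ℝ) := by
        have : (Y ^ j : ℝ) = Y ^ 2 * Y ^ (j - 2) := by rw [← pow_add]; congr 1; omega
        rw [this, mul_inv]; field_simp
      calc K * (((1 + |M * ((ℓ : ℝ) - x)|) ^ 2)⁻¹ * ((1 + |M * ((ℓ : ℝ) - x)|) ^ (j - 2))⁻¹)
          ≤ K * (((1 + |(ℓ : ℝ) - x|) ^ 2)⁻¹ * (Y ^ (j - 2))⁻¹) := by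
            refine mul_le_mul_of_nonneg_left ?_ hK
            exact mul_le_mul (inv_anti₀ (by positivity) h3) (inv_anti₀ (by positivity) h2) (by positivity) (by positivity)
        _ = K * (Y ^ 2 * (Y ^ j)⁻¹) * ((1 + |(ℓ : ℝ) - x|) ^ 2)⁻¹ := by rw [mul_comm (Y ^ 2), hYj]; ring
    calc M * ‖Φ (M * (ℓ - x))‖ ≤ M * (K / (1 + |M * ((ℓ : ℝ) - x)|) ^ j) := mul_le_mul_of_nonneg_left h1 hM0.le
      _ ≤ M * (K * Y ^ ((2 : ℝ) - j) * ((1 + |(ℓ : ℝ) - x|) ^ 2)⁻¹) := mul_le_mul_of_nonneg_left h4 hM0.le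
      _ = _ := by ring
  calc ∑ ℓ ∈ F, M * ‖Φ (M * (ℓ - x))‖ ≤ ∑ ℓ ∈ F, K * M * Y ^ ((2 : ℝ) - j) * ((1 + |(ℓ : ℝ) - x|) ^ 2)⁻¹ :=
        Finset.sum_le_sum hterm
    _ = K * M * Y ^ ((2 : ℝ) - j) * ∑ ℓ ∈ F, ((1 + |(ℓ : ℝ) - x|) ^ 2)⁻¹ := by rw [Finset.mul_sum]
    _ ≤ K * M * Y ^ ((2 : ℝ) - j) * 8 := mul_le_mul_of_nonneg_left (sum_inv_one_add_sq_le F x) (by positivity)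
    _ = _ := by ring

/-- **The tail in `ℓ`**: if `‖Φ(y)‖ ≤ K(1+|y|)^{-j}` with `j ≥ 2`, `M ≥ 1`, `|x| ≤ X` and `L ≥ X + 1`, then for
every finite set `F` of integers with `|ℓ| ≥ L` on `F`, `∑_{ℓ∈F} M‖Φ(M(ℓ−x))‖ ≤ 8KM (L−X)^{2−j}`.
[cite: GuthMaynard2026, proof of Lemma 9.2] -/
theorem sum_tail_le {Φ : ℝ → ℂ} {K : ℝ} (hK : 0 ≤ K) {j : ℕ} (hj : 2 ≤ j)
    (hΦ : ∀ y, ‖Φ y‖ ≤ K / (1 + |y|) ^ j) {M : ℝ} (hM : 1 ≤ M) {X L : ℝ} (hL : X + 1 ≤ L)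
    {x : ℝ} (hx : |x| ≤ X) (F : Finset ℤ) (hF : ∀ ℓ ∈ F, L ≤ |(ℓ : ℝ)|) :
    ∑ ℓ ∈ F, M * ‖Φ (M * (ℓ - x))‖ ≤ 8 * K * M * (L - X) ^ ((2 : ℝ) - j) := by
  have hLX : 1 ≤ L - X := by linarith
  refine sum_far_le hK hj hΦ hM hLX x F fun ℓ hℓ ↦ ?_
  have h1 : L - X ≤ |(ℓ : ℝ) - x| := by
    have := abs_sub_abs_le_abs_sub (ℓ : ℝ) x
    linarith [hF ℓ hℓ]
  exact h1.trans (le_mul_of_one_le_left (abs_nonneg _) hM)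

/-! ## §4. Counting -/

/-- **Integers in an interval**: a finite set of integers within distance `R` of a real `ξ` has at most
`2R + 1` elements. [folklore] -/
theorem card_int_near_le (ξ : ℝ) {R : ℝ} (hR : 0 ≤ R) (F : Finset ℤ) (hF : ∀ s ∈ F, |(s : ℝ) - ξ| ≤ R) :
    (F.card : ℝ) ≤ 2 * R + 1 := by
  have hsub : F ⊆ Finset.Icc ⌈ξ - R⌉ ⌊ξ + R⌋ := by
    intro s hs
    have h := hF s hs
    rw [abs_le] at h
    rw [Finset.mem_Icc]
    exact ⟨Int.ceil_le.mpr (by linarith), Int.le_floor.mpr (by linarith)⟩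
  have h1 : (F.card : ℝ) ≤ ((Finset.Icc ⌈ξ - R⌉ ⌊ξ + R⌋).card : ℝ) := by exact_mod_cast Finset.card_le_card hsub
  refine h1.trans ?_
  rw [Int.card_Icc]
  have h2 : ((⌊ξ + R⌋ + 1 - ⌈ξ - R⌉).toNat : ℝ) ≤ max (((⌊ξ + R⌋ + 1 - ⌈ξ - R⌉ : ℤ) : ℝ)) 0 := by
    rcases le_or_gt 0 (⌊ξ + R⌋ + 1 - ⌈ξ - R⌉) with h | h
    · rw [max_eq_left (by exact_mod_cast h)]; exact_mod_cast (Int.toNat_of_nonneg h).le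
    · rw [Int.toNat_eq_zero.mpr h.le]; simp
  refine h2.trans (max_le ?_ (by linarith))
  push_cast
  have := Int.floor_le (ξ + R)
  have := Int.le_ceil (ξ - R)
  linarith

/-- **Factorisations**: for a non-zero integer `s` and finite sets `A, B ⊂ ℤ`, the number of pairs
`(m, ℓ) ∈ A × B` with `mℓ = s` is at most `2·d(|s|)` ("each such integer `s` has `⪅ 1` factorizations as
`s = m₁ℓ`", with the divisor bound). [cite: GuthMaynard2026, proof of Lemma 9.2] -/
theorem card_mul_eq_le (A B : Finset ℤ) {s : ℤ} (hs : s ≠ 0) :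
    ((A ×ˢ B).filter fun p : ℤ × ℤ ↦ p.1 * p.2 = s).card ≤ 2 * s.natAbs.divisors.card := by
  classical
  set P := (A ×ˢ B).filter fun p : ℤ × ℤ ↦ p.1 * p.2 = s with hP
  set φ : ℤ × ℤ → ℕ := fun p ↦ p.1.natAbs with hφ
  have hfib : ∀ a ∈ P.image φ, (P.filter fun p ↦ φ p = a).card ≤ 2 := by
    intro a _
    have hsub : (P.filter fun p ↦ φ p = a) ⊆ {((a : ℤ), s / a), (-(a : ℤ), s / (-(a : ℤ)))} := by
      intro p hp
      rw [Finset.mem_filter] at hp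
      obtain ⟨hpP, hpa⟩ := hp
      rw [hP, Finset.mem_filter] at hpP
      have hmul : p.1 * p.2 = s := hpP.2
      have hp1 : p.1 ≠ 0 := by intro h; rw [h, zero_mul] at hmul; exact hs hmul.symm
      have hp2 : p.2 = s / p.1 := by rw [← hmul, Int.mul_ediv_cancel_left _ hp1]
      simp only [hφ] at hpa
      rcases Int.natAbs_eq_iff.mp hpa with h | h
      · rw [Finset.mem_insert]; left
        rw [← h]; exact Prod.ext rfl hp2
      · rw [Finset.mem_insert, Finset.mem_singleton]; right
        rw [← h]; exact Prod.ext rfl hp2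
    exact (Finset.card_le_card hsub).trans (Finset.card_le_two)
  have himg : P.image φ ⊆ s.natAbs.divisors := by
    intro a ha
    rw [Finset.mem_image] at ha
    obtain ⟨p, hp, rfl⟩ := ha
    rw [hP, Finset.mem_filter] at hp
    rw [Nat.mem_divisors]
    refine ⟨?_, Int.natAbs_ne_zero.mpr hs⟩
    have : p.1 ∣ s := Dvd.intro _ hp.2
    exact Int.natAbs_dvd_natAbs.mpr this
  calc P.card ≤ 2 * (P.image φ).card := Finset.card_le_mul_card_image _ 2 hfib
    _ ≤ 2 * s.natAbs.divisors.card := Nat.mul_le_mul_left 2 (Finset.card_le_card himg)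

end GuthMaynardAffine

end Literature.NumberTheory.LFunctions

end
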